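import Summits.Ventures.HodgeRepro2.T5HyperbolicUnitaryElements
import Summits.Ventures.HodgeRepro2.T5CartanFinOne
import Summits.Ventures.HodgeRepro2.T5LocalFieldUnitsDecomposition

/-!
# T5CartanUnitaryRankOne — the Cartan decomposition of `U(1,1)` PROVED

Blind cell pub-hodge-repro2, seat p8, Tier-5 kernel support. T5UnitaryHeckeAdjoint consumes the printed
Cartan decomposition of the unramified unitary group as the hypothesis `IsCartanDecomposition R J σ ϖ`;
T5CartanFinOne proved it for `U(1)`. This file proves it for the hyperbolic plane — `J = antidiag(1, 1)`,
`U(J) = U(1,1)` — on top of T5HyperbolicUnitaryElements: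

* an entry `a = g i j` of maximal value under the valuation of the valuation ring `R ⊂ E` divides every entry
  (`exists_dvd_of_finite`: `Finset.exists_max_image` on `ValuationRing.valuation R E`);
* the Weyl element `J` (rows / columns swapped) moves it to the corner `(0,0)`;
* the isotropy relations make `y = −c/a` and `y' = −b/a` purely imaginary, so the integral unipotents
  `n⁻(y)`, `n(y')` lie in `K_U` and `n⁻(y) · g · n(y') = diag(a, star(a)⁻¹)` (T5HyperbolicUnitaryElements);
* `a = u ϖ^k` (p4's `exists_unit_mul_zpow`), `diag(u, star(u)⁻¹) ∈ K_U`, and `diag(ϖ^k, ϖ^{-k})` is the torus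
  element `diag(ϖ^m)` with `m = ![k, −k]`, `m ∘ rev = −m` (`diagonalUnit_factor`).

MAIN: `isCartanDecomposition_hyperbolic` — for `R` a DVR with fraction field `E`, an involution of `E`
preserving `R`-integrality, and a uniformiser `ϖ` fixed by the involution,
`IsCartanDecomposition R (antidiag(1,1)) Fin.revPerm ϖ` holds. Hence (T5UnitaryHeckeAdjoint) the Hecke algebra
of `U(1,1)` at such a place is commutative (`heckeAlgebra_mul_comm_hyperbolic`), with multiplicity one and
self-adjoint `T_g`, with NO hypothesis beyond the ring-theoretic ones. The record's `U(2,1)` (dimension 3)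
remains the printed hypothesis.
-/

namespace Summit.Ventures.HodgeRepro2.T5CartanUnitaryRankOne

open Summit.Ventures.HodgeRepro2 Matrix T5HyperbolicUnitaryElements T5UnipotentCommutator

section Valuation

variable {R : Type*} [CommRing R] [IsDomain R] [ValuationRing R] {E : Type*} [Field E] [Algebra R E]
  [IsFractionRing R E]

/-- In the fraction field of a valuation ring, among finitely many elements not all zero there is one
dividing all the others (`Finset.exists_max_image` on `ValuationRing.valuation`). -/
theorem exists_dvd_of_finite {ι : Type*} [Fintype ι] [Nonempty ι] (x : ι → E) (hx : ∃ i, x i ≠ 0) :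
    ∃ i, x i ≠ 0 ∧ ∀ j, IsLocalization.IsInteger R (x j / x i) := by
  obtain ⟨i, -, hi⟩ := Finset.exists_max_image Finset.univ (fun j => ValuationRing.valuation R E (x j))
    Finset.univ_nonempty
  obtain ⟨i₀, hi₀⟩ := hx
  have hvi : ValuationRing.valuation R E (x i) ≠ 0 := by
    intro h
    have := hi i₀ (Finset.mem_univ _)
    rw [h, le_zero_iff, (ValuationRing.valuation R E).zero_iff] at this
    exact hi₀ this
  refine ⟨i, (ValuationRing.valuation R E).ne_zero_iff.1 hvi, fun j => ?_⟩
  show ∃ a, algebraMap R E a = x j / x i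
  rw [← ValuationRing.mem_integer_iff, Valuation.mem_integer_iff, Valuation.map_div,
    div_le_one₀ (zero_lt_iff.2 hvi)]
  exact hi j (Finset.mem_univ _)

end Valuation

section Main

variable {R : Type*} [CommRing R] [IsDomain R] [IsDiscreteValuationRing R] {E : Type*} [Field E]
  [StarRing E] [Algebra R E] [IsFractionRing R E]

omit [IsDomain R] [IsDiscreteValuationRing R] [IsFractionRing R E] in
/-- `diag(a, star(a)⁻¹) = diag(u, star(u)⁻¹) · diag(ϖ^k, ϖ^{-k})` (p3's `diagUnit`) when `a = u ϖ^k`,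
`star ϖ = ϖ`. -/
theorem diagUnit_factor {a : E} (ha : a ≠ 0) (u : Rˣ) (ϖ : R) (hϖ : algebraMap R E ϖ ≠ 0)
    (hϖs : star (algebraMap R E ϖ) = algebraMap R E ϖ) (k : ℤ)
    (hak : a = algebraMap R E u * algebraMap R E ϖ ^ k) :
    diagUnit a ha = diagUnit (algebraMap R E u) (Units.ne_zero (Units.map (algebraMap R E).toMonoidHom u)) *
      T5CartanUniformiser.diagonalUnit (fun i => Units.mk0 (algebraMap R E ϖ) hϖ ^ (![k, -k] i)) := by
  apply Units.ext
  rw [Units.val_mul, coe_diagUnit, coe_diagUnit, coe_diagonalUnit_zpow_fin_two, Matrix.mul_fin_two,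
    fin_two_eq_iff]
  simp only [Units.val_zpow_eq_zpow_val, Units.val_mk0]
  refine ⟨by rw [hak]; ring, by ring, by ring, ?_⟩
  rw [hak, star_mul, star_zpow₀, hϖs, mul_inv, _root_.zpow_neg]
  ring

/-- THE CORNER CASE: `g ∈ U(1,1)` with `a = g 0 0 ≠ 0` dividing `b = g 0 1` and `c = g 1 0` is
`k₁ · diag(ϖ^{m}) · k₂` with `k₁, k₂ ∈ K_U` and `m ∘ rev = −m`. -/
theorem exists_cartan_of_corner
    (hstar : ∀ x : E, IsLocalization.IsInteger R x → IsLocalization.IsInteger R (star x))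
    (ϖ : R) (hϖ : Irreducible ϖ) (hϖs : star (algebraMap R E ϖ) = algebraMap R E ϖ)
    (g : T5UnitaryGroupForm.formUnitaryGroup (hyperbolicGram E))
    (ha : ((g : GL (Fin 2) E) : Matrix (Fin 2) (Fin 2) E) 0 0 ≠ 0)
    (hb : IsLocalization.IsInteger R (((g : GL (Fin 2) E) : Matrix (Fin 2) (Fin 2) E) 0 1 /
      ((g : GL (Fin 2) E) : Matrix (Fin 2) (Fin 2) E) 0 0))
    (hc : IsLocalization.IsInteger R (((g : GL (Fin 2) E) : Matrix (Fin 2) (Fin 2) E) 1 0 /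
      ((g : GL (Fin 2) E) : Matrix (Fin 2) (Fin 2) E) 0 0)) :
    ∃ k₁ ∈ T5UnitaryHeckeAdjoint.hyperspecialSubgroup R (hyperbolicGram E),
    ∃ k₂ ∈ T5UnitaryHeckeAdjoint.hyperspecialSubgroup R (hyperbolicGram E),
    ∃ m : Fin 2 → ℤ, (∀ i, m (Fin.revPerm i) = - m i) ∧
      (g : GL (Fin 2) E) = k₁ * T5CartanUniformiser.diagonalUnit
        (fun i => Units.mk0 (algebraMap R E ϖ)
          ((map_ne_zero_iff _ (IsFractionRing.injective R E)).2 hϖ.ne_zero) ^ m i) * k₂ := by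
  set a := ((g : GL (Fin 2) E) : Matrix (Fin 2) (Fin 2) E) 0 0
  set b := ((g : GL (Fin 2) E) : Matrix (Fin 2) (Fin 2) E) 0 1
  set c := ((g : GL (Fin 2) E) : Matrix (Fin 2) (Fin 2) E) 1 0
  set d := ((g : GL (Fin 2) E) : Matrix (Fin 2) (Fin 2) E) 1 1
  have hg : ((g : GL (Fin 2) E) : Matrix (Fin 2) (Fin 2) E) = !![a, b; c, d] := Matrix.eta_fin_two _
  obtain ⟨h1, h2, -, -⟩ := (mem_iff_fin_two (g : GL (Fin 2) E) a b c d hg).1 g.2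
  -- the two purely imaginary integral unipotent parameters
  have hy : star (-(c / a)) = -(-(c / a)) := star_neg_div_of_rel ha h1
  have hyI : IsLocalization.IsInteger R (c / a) := hc
  have hy'I : IsLocalization.IsInteger R (b / a) := hb
  -- g₁ = n⁻(y) g is upper triangular and in U(1,1): its (2,2) relation makes −b/a purely imaginary
  have hg1 : ((lowerUnip (-(c / a)) * (g : GL (Fin 2) E) : GL (Fin 2) E) : Matrix (Fin 2) (Fin 2) E) =
      !![a, b; 0, (star a)⁻¹] := by
    rw [Units.val_mul, coe_lowerUnip, hg, lowerUnip_mul ha h1 h2]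
  have hmem1 : lowerUnip (-(c / a)) * (g : GL (Fin 2) E) ∈
      T5UnitaryGroupForm.formUnitaryGroup (hyperbolicGram E) := mul_mem (lowerUnip_mem hy) g.2
  obtain ⟨-, -, -, h4⟩ := (mem_iff_fin_two _ a b 0 (star a)⁻¹ hg1).1 hmem1
  have hy' : star (-(b / a)) = -(-(b / a)) := star_neg_div_of_upper h4
  -- the diagonal part
  have hD : ((lowerUnip (-(c / a)) * (g : GL (Fin 2) E) * unipUnit (-(b / a)) : GL (Fin 2) E) :
      Matrix (Fin 2) (Fin 2) E) = !![a, 0; 0, (star a)⁻¹] := by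
    rw [Units.val_mul, hg1]
    change !![a, b; 0, (star a)⁻¹] * unip (-(b / a)) = _
    rw [unip, Matrix.mul_fin_two, fin_two_eq_iff]
    refine ⟨by ring, by field_simp; ring, by ring, by ring⟩
  have hDunit : lowerUnip (-(c / a)) * (g : GL (Fin 2) E) * unipUnit (-(b / a)) = diagUnit a ha := by
    apply Units.ext
    rw [hD, coe_diagUnit]
  -- a = u ϖ^k
  obtain ⟨u, k, hak⟩ := T5LocalFieldUnitsDecomposition.exists_unit_mul_zpow ϖ hϖ a ha
  have hϖE : algebraMap R E ϖ ≠ 0 := (map_ne_zero_iff _ (IsFractionRing.injective R E)).2 hϖ.ne_zero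
  have huE : (algebraMap R E u : E) ≠ 0 := Units.ne_zero (Units.map (algebraMap R E).toMonoidHom u)
  have huI : IsLocalization.IsInteger R (algebraMap R E u) := ⟨u, rfl⟩
  have huI' : IsLocalization.IsInteger R (algebraMap R E u)⁻¹ :=
    ⟨((u⁻¹ : Rˣ) : R), by rw [map_units_inv]⟩
  have hsI : IsLocalization.IsInteger R (star (algebraMap R E u)) := hstar _ huI
  have hsI' : IsLocalization.IsInteger R (star (algebraMap R E u))⁻¹ := by
    rw [← star_inv₀]; exact hstar _ huI'
  -- the torus factor
  have hfac := diagUnit_factor ha u ϖ hϖE hϖs k hak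
  -- assemble
  refine ⟨⟨lowerUnip (c / a) * diagUnit (algebraMap R E u) huE, ?_⟩, ?_,
    ⟨unipUnit (b / a), ?_⟩, ?_, ![k, -k], ?_, ?_⟩
  · refine mul_mem ?_ (diagUnit_mem _ _)
    have := lowerUnip_mem (y := -(-(c / a))) (by rw [star_neg, hy, neg_neg])
    rwa [neg_neg] at this
  · rw [T5UnitaryHeckeAdjoint.mem_hyperspecialSubgroup_iff]
    exact mul_mem (lowerUnip_mem_range hyI) (diagUnit_mem_range huE huI huI' hsI hsI')
  · have := (unipUnit_mem_iff (-(-(b / a)))).2 (by rw [star_neg, hy', neg_neg])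
    rwa [neg_neg] at this
  · rw [T5UnitaryHeckeAdjoint.mem_hyperspecialSubgroup_iff]
    exact unipUnit_mem_range hy'I
  · intro i; fin_cases i <;> simp
  · -- g = n⁻(c/a) · diag · n(b/a)
    show (g : GL (Fin 2) E) = lowerUnip (c / a) * diagUnit (algebraMap R E u) huE *
      T5CartanUniformiser.diagonalUnit (fun i => Units.mk0 (algebraMap R E ϖ) _ ^ (![k, -k] i)) *
      unipUnit (b / a)
    have key : (g : GL (Fin 2) E) = (lowerUnip (-(c / a)))⁻¹ *
        (lowerUnip (-(c / a)) * (g : GL (Fin 2) E) * unipUnit (-(b / a))) *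
          (unipUnit (-(b / a)))⁻¹ := by
      group
    rw [key, hDunit, hfac, lowerUnip_inv, unipUnit_inv, neg_neg, neg_neg, mul_assoc, mul_assoc,
      mul_assoc, mul_assoc]

/-- THE CARTAN DECOMPOSITION OF `U(1,1)`: for `R` a DVR with fraction field `E`, an involution of `E`
preserving `R`-integrality and a uniformiser `ϖ` fixed by it, `IsCartanDecomposition R (antidiag(1,1)) Fin.revPerm ϖ`
holds — every `g ∈ U(1,1)` is `k₁ · diag(ϖ^k, ϖ^{-k}) · k₂` with `k₁, k₂ ∈ K_U`. -/
theorem isCartanDecomposition_hyperbolic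
    (hstar : ∀ x : E, IsLocalization.IsInteger R x → IsLocalization.IsInteger R (star x))
    (ϖ : R) (hϖ : Irreducible ϖ) (hϖs : star (algebraMap R E ϖ) = algebraMap R E ϖ) :
    T5UnitaryHeckeAdjoint.IsCartanDecomposition R (hyperbolicGram E) Fin.revPerm
      (Units.mk0 (algebraMap R E ϖ) ((map_ne_zero_iff _ (IsFractionRing.injective R E)).2 hϖ.ne_zero)) := by
  intro g
  -- an entry of maximal valuation
  have hne : ∃ p : Fin 2 × Fin 2, ((g : GL (Fin 2) E) : Matrix (Fin 2) (Fin 2) E) p.1 p.2 ≠ 0 := by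
    by_contra hcon
    have h0 : ((g : GL (Fin 2) E) : Matrix (Fin 2) (Fin 2) E) = 0 := by
      ext i j
      by_contra h
      exact hcon ⟨(i, j), h⟩
    have := Units.mul_inv (g : GL (Fin 2) E)
    rw [h0, zero_mul] at this
    exact zero_ne_one this
  obtain ⟨p, hp, hdiv⟩ := exists_dvd_of_finite (R := R)
    (fun q : Fin 2 × Fin 2 => ((g : GL (Fin 2) E) : Matrix (Fin 2) (Fin 2) E) q.1 q.2) hne
  let w : T5UnitaryGroupForm.formUnitaryGroup (hyperbolicGram E) :=
    ⟨T5CartanDominant.permUnit E (Fin.revPerm : Equiv.Perm (Fin 2)), permUnit_rev_mem⟩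
  have hwK : w ∈ T5UnitaryHeckeAdjoint.hyperspecialSubgroup R (hyperbolicGram E) :=
    (T5UnitaryHeckeAdjoint.mem_hyperspecialSubgroup_iff R w).2 (permUnit_rev_mem_range (R := R))
  set a := ((g : GL (Fin 2) E) : Matrix (Fin 2) (Fin 2) E) 0 0
  set b := ((g : GL (Fin 2) E) : Matrix (Fin 2) (Fin 2) E) 0 1
  set c := ((g : GL (Fin 2) E) : Matrix (Fin 2) (Fin 2) E) 1 0
  set d := ((g : GL (Fin 2) E) : Matrix (Fin 2) (Fin 2) E) 1 1
  have hg : ((g : GL (Fin 2) E) : Matrix (Fin 2) (Fin 2) E) = !![a, b; c, d] := Matrix.eta_fin_two _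
  have hgw : ((g * w : T5UnitaryGroupForm.formUnitaryGroup (hyperbolicGram E)) : GL (Fin 2) E) =
      (g : GL (Fin 2) E) * T5CartanDominant.permUnit E (Fin.revPerm : Equiv.Perm (Fin 2)) := rfl
  have hwg : ((w * g : T5UnitaryGroupForm.formUnitaryGroup (hyperbolicGram E)) : GL (Fin 2) E) =
      T5CartanDominant.permUnit E (Fin.revPerm : Equiv.Perm (Fin 2)) * (g : GL (Fin 2) E) := rfl
  obtain ⟨i, j⟩ := p
  fin_cases i <;> fin_cases j
  · -- corner (0,0)
    exact exists_cartan_of_corner hstar ϖ hϖ hϖs g hp (hdiv (0, 1)) (hdiv (1, 0))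
  · -- (0,1): use g * w, whose corner is b
    have h := exists_cartan_of_corner hstar ϖ hϖ hϖs (g * w) ?_ ?_ ?_
    · obtain ⟨k₁, hk₁, k₂, hk₂, m, hm, hdec⟩ := h
      refine ⟨k₁, hk₁, k₂ * w⁻¹, mul_mem hk₂ (inv_mem hwK), m, hm, ?_⟩
      rw [Subgroup.coe_mul, Subgroup.coe_inv, ← mul_assoc, ← hdec, hgw]
      exact (mul_inv_cancel_right _ _).symm
    all_goals rw [hgw, mul_permUnit_rev _ a b c d hg]
    · exact hp
    · simpa using hdiv (0, 0)
    · simpa using hdiv (1, 1)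
  · -- (1,0): use w * g, whose corner is c
    have h := exists_cartan_of_corner hstar ϖ hϖ hϖs (w * g) ?_ ?_ ?_
    · obtain ⟨k₁, hk₁, k₂, hk₂, m, hm, hdec⟩ := h
      refine ⟨w⁻¹ * k₁, mul_mem (inv_mem hwK) hk₁, k₂, hk₂, m, hm, ?_⟩
      rw [Subgroup.coe_mul, Subgroup.coe_inv, mul_assoc, mul_assoc, ← mul_assoc (k₁ : GL (Fin 2) E),
        ← hdec, hwg]
      exact (inv_mul_cancel_left _ _).symm
    all_goals rw [hwg, permUnit_rev_mul _ a b c d hg]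
    · exact hp
    · simpa using hdiv (1, 1)
    · simpa using hdiv (0, 0)
  · -- (1,1): use w * g * w, whose corner is d
    have hwgw : ((w * g * w : T5UnitaryGroupForm.formUnitaryGroup (hyperbolicGram E)) : GL (Fin 2) E) =
        T5CartanDominant.permUnit E (Fin.revPerm : Equiv.Perm (Fin 2)) * (g : GL (Fin 2) E) *
          T5CartanDominant.permUnit E (Fin.revPerm : Equiv.Perm (Fin 2)) := rfl
    have hmat : (((w * g * w : T5UnitaryGroupForm.formUnitaryGroup (hyperbolicGram E)) : GL (Fin 2) E) :
        Matrix (Fin 2) (Fin 2) E) = !![d, c; b, a] := by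
      rw [hwgw, mul_permUnit_rev _ c d a b (permUnit_rev_mul _ a b c d hg)]
    have h := exists_cartan_of_corner hstar ϖ hϖ hϖs (w * g * w) ?_ ?_ ?_
    · obtain ⟨k₁, hk₁, k₂, hk₂, m, hm, hdec⟩ := h
      refine ⟨w⁻¹ * k₁, mul_mem (inv_mem hwK) hk₁, k₂ * w⁻¹, mul_mem hk₂ (inv_mem hwK), m, hm, ?_⟩
      simp only [Subgroup.coe_mul, Subgroup.coe_inv]
      have : (g : GL (Fin 2) E) = (w : GL (Fin 2) E)⁻¹ *
          ((w * g * w : T5UnitaryGroupForm.formUnitaryGroup (hyperbolicGram E)) : GL (Fin 2) E) *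
          (w : GL (Fin 2) E)⁻¹ := by
        simp only [Subgroup.coe_mul]; group
      rw [this, hdec]; group
    all_goals rw [hmat]
    · exact hp
    · simpa using hdiv (1, 0)
    · simpa using hdiv (0, 1)

/-- `H(U(1,1), K_U)` IS COMMUTATIVE — `R` a DVR with finite residue field, `E = Frac R`, an involution of `E`
preserving `R`-integrality, a uniformiser fixed by it: NO Cartan hypothesis left
(T5UnitaryHeckeAdjoint + `isCartanDecomposition_hyperbolic`). -/
theorem heckeAlgebra_mul_comm_hyperbolic [Finite (IsLocalRing.ResidueField R)]
    (hstar : ∀ x : E, IsLocalization.IsInteger R x → IsLocalization.IsInteger R (star x))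
    (ϖ : R) (hϖ : Irreducible ϖ) (hϖs : star (algebraMap R E ϖ) = algebraMap R E ϖ) (k : Type*) [Field k]
    (T S : T5HeckePermutationModule.heckeAlgebra k
      (T5UnitaryHeckeAdjoint.hyperspecialSubgroup R (hyperbolicGram E))) : T * S = S * T :=
  T5UnitaryHeckeAdjoint.heckeAlgebra_mul_comm
    (T5AntidiagonalForm.antidiagonalMatrix_rev_rev ![1, 1] (fun i => by fin_cases i <;> rfl))
    (isCartanDecomposition_hyperbolic hstar ϖ hϖ hϖs) k T S

end Main

end Summit.Ventures.HodgeRepro2.T5CartanUnitaryRankOne
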